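import Literature.MathematicalPhysics.QuantumLattice.QuantumRotorTruncated
import Literature.MathematicalPhysics.QuantumLattice.XYOrderGDProofs
import Literature.Probability.LatticeModels.GaussianDomination
import HarnessLib

/-!
# Truncated quantum rotators: Gaussian domination for the ground-state energy

Sibling file of `QuantumRotorGroundState.lean` / `QuantumRotorTruncated.lean` (item
`provefact-Literature.MathematicalPhysics.QuantumLa-0bccfc6de5`, the named fact
`QuantumRotor.KleinPerez1992_rotorGroundStateLRO`). No statement of those files is touched. This
file proves the one analytic input of the Kennedy–Lieb–Shastry `T = 0` infrared bound for the
Galerkin matrices `H_M = Σ_x (h/2)N_x² - J Σ_{⟨xy⟩} (cos_x cos_y + sin_x sin_y)`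
(`truncHamiltonian M (torusGraph d L).Adj h J`) of the quantum rotators on the even discrete tori:
**Gaussian domination for the ground-state energy**,

* `truncHamiltonian_groundEnergy_le_field` — for even `L ≥ 4`, `J ≥ 0`, every `h`, `M` and every
  real field `b` on the torus, `E₀(H_M) ≤ E₀(H_M(b))`, where
  `H_M(b) = H_M - J Σ_{⟨xy⟩} (b_x - b_y)(cos_x - cos_y) + (J/2) Σ_{⟨xy⟩} (b_x - b_y)²`
  (`rotorFieldHamiltonian`: the `cos·cos` part of every bond completed to the square
  `½(cos_x - cos_y - b_x + b_y)²`).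

This is Thm. 3.5 (`E₀(b) ≥ E₀(0)`) of Wojtkiewicz–Pusz–Stachura, Rep. Math. Phys. 77 (2016)
(arXiv:1507.03079), there derived from an operator reflection-positivity inequality; here it is
proved, for the Galerkin matrices, by the direct ground-state argument of Kennedy–Lieb–Shastry,
J. Stat. Phys. 53 (1988) 1019–1030, pp. 1027–1029, eqs. (15)–(25), exactly as the tree does for the
quantum XY model (`XYOrderReflection.lean`, `XYOrderGDProofs.lean`, whose model-independent parts —
the halves of the even torus, the tensor-square identification `torusSplit`, the embeddings
`torusLeftEmbed`/`torusRightEmbed`, the bond geometry `sum_edgeFinset_split`, the abstract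
reflection inequality `Matrix.kls_groundEnergy_reflection`, the bad-bond count
`badBondCount_reflect` — are reused verbatim):

* in the momentum basis `cos` is real symmetric, `i·sin` real antisymmetric and `N²` real
  diagonal (`QuantumRotorTruncated.lean`); the momentum flip `F` (`φ ↦ -φ`: `F cos F = cos`,
  `F sin F = -sin`, `F N² F = N²`) on the odd sublattice of the bipartite even torus conjugates
  `H_M(b)` into the "rotated" Hamiltonian `H♭(b)` (`rotorRealFieldHamiltonian`) all of whose bond
  terms are `-J cos_x cos_y - J (i sin_x)(i sin_y) + field terms` with real matrices
  (`groundEnergy_rotorFieldHamiltonian_eq`; [KLS1988JSP] eqs. (15)–(17));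
* along every pair of reflection planes, `H♭(b) = H^L ⊗ 1 + 1 ⊗ H^L(b ∘ θ) - Σᵢ Mᵢ(b) ⊗ Mᵢ(b ∘ θ)`
  with `H^L` complex-symmetric and `Mᵢ` real (`rotorRealFieldHamiltonian_eq_submatrix`,
  eq. (21); the kinetic terms are on-site and split between the halves), whence
  `½E(b^L) + ½E(b^R) ≤ E(b)` (`groundEnergy_reflect_le_rotor`, eqs. (20)–(25));
* the descent on the number of bonds with `b_x ≠ b_y` (p. 1027, p. 1029).

## References

* [WojtkiewiczPuszStachura2016] J. Wojtkiewicz, W. Pusz, P. Stachura, *Operator reflection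
  positivity inequalities and their applications to interacting quantum rotors*, Rep. Math. Phys.
  77 (2016) 183–209, Thm. 2.3, Thm. 3.5, Lemma 3.6.
* [KLS1988JSP] T. Kennedy, E. H. Lieb, B. S. Shastry, *Existence of Néel order in some spin-½
  Heisenberg antiferromagnets*, J. Stat. Phys. 53 (1988) 1019–1030, eqs. (15)–(25).
* [DLS1978] F. J. Dyson, E. H. Lieb, B. Simon, J. Stat. Phys. 18 (1978) 335–383 (Gaussian
  domination at positive temperature).
-/

noncomputable section

open Matrix Complex Finset
open scoped ComplexOrder Kronecker
open Literature.Probability.LatticeModels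

namespace Literature.MathematicalPhysics.QuantumLattice

namespace QuantumRotor

variable {d : ℕ}

/-! ### The rotated bond term and the field Hamiltonians -/

section Defs

variable (M : ℕ) {Λ : Type*} [Fintype Λ] [DecidableEq Λ]

/-- The symmetrised bond `½(cos_x cos_y + cos_y cos_x)` (`= cos_x cos_y` for `x ≠ y`).
[cite: WojtkiewiczPuszStachura2016, §3.1] -/
def cosBond (x y : Λ) : Op Λ (2 * M + 1) :=
  (1 / 2 : ℂ) • (siteCos M x * siteCos M y + siteCos M y * siteCos M x)

/-- The symmetrised bond `½(sin_x sin_y + sin_y sin_x)` (`= sin_x sin_y` for `x ≠ y`).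
[cite: WojtkiewiczPuszStachura2016, §3.1] -/
def sinBond (x y : Λ) : Op Λ (2 * M + 1) :=
  (1 / 2 : ℂ) • (siteSin M x * siteSin M y + siteSin M y * siteSin M x)

/-- `cosBond` is symmetric by construction. [folklore] -/
theorem cosBond_comm (x y : Λ) : cosBond M x y = cosBond M y x := by
  rw [cosBond, cosBond, add_comm (siteCos M x * siteCos M y)]

/-- `sinBond` is symmetric by construction. [folklore] -/
theorem sinBond_comm (x y : Λ) : sinBond M x y = sinBond M y x := by
  rw [sinBond, sinBond, add_comm (siteSin M x * siteSin M y)]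

/-- `cosBond + sinBond = truncBond` (the compression of `cos(φ_x - φ_y)`). [folklore] -/
theorem cosBond_add_sinBond (x y : Λ) : cosBond M x y + sinBond M x y = truncBond M x y := by
  have h1 : siteCos M y * siteCos M x + siteSin M y * siteSin M x = truncBond M x y :=
    truncBond_comm M y x
  have h2 : siteCos M x * siteCos M y + siteSin M x * siteSin M y = truncBond M x y := rfl
  calc cosBond M x y + sinBond M x y
      = (1 / 2 : ℂ) • ((siteCos M x * siteCos M y + siteSin M x * siteSin M y) +
          (siteCos M y * siteCos M x + siteSin M y * siteSin M x)) := by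
        rw [cosBond, sinBond, ← smul_add]
        congr 1
        abel
    _ = truncBond M x y := by
        rw [h1, h2, ← two_smul ℂ, smul_smul]
        norm_num

/-- `cosBond` is Hermitian. [folklore] -/
theorem cosBond_isHermitian (x y : Λ) : (cosBond M x y).IsHermitian := by
  have hx := siteCos_isHermitian M x
  have hy := siteCos_isHermitian M y
  unfold cosBond
  rw [IsHermitian, conjTranspose_smul, conjTranspose_add, conjTranspose_mul, conjTranspose_mul,
    hx.eq, hy.eq, add_comm (siteCos M y * siteCos M x), show star (1 / 2 : ℂ) = 1 / 2 by simp]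

/-- `sinBond` is Hermitian. [folklore] -/
theorem sinBond_isHermitian (x y : Λ) : (sinBond M x y).IsHermitian := by
  have hx := siteSin_isHermitian M x
  have hy := siteSin_isHermitian M y
  unfold sinBond
  rw [IsHermitian, conjTranspose_smul, conjTranspose_add, conjTranspose_mul, conjTranspose_mul,
    hx.eq, hy.eq, add_comm (siteSin M y * siteSin M x), show star (1 / 2 : ℂ) = 1 / 2 by simp]

/-- The bond term of the rotated field Hamiltonian:
`τ_b(x, y) = -J cosBond + J sinBond - J(b_x - b_y)(cos_x - cos_y) + ½J(b_x - b_y)²`, i.e.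
`½J(T¹_x - T¹_y - b_x + b_y)² + ½J(T²_x - T²_y)² - on-site squares` with the real matrices
`T¹ = cos`, `T² = i·sin` — the rotator analogue of the summand of [KLS1988JSP] eq. (17) after the
momentum flip on one sublattice which turns `-J sin_x sin_y` into `+J sin_x sin_y = -J T²_x T²_y`
(eqs. (15)–(16)). Symmetric in `x`, `y`. [cite: KLS1988JSP, eqs. (15)–(17)]
[cite: WojtkiewiczPuszStachura2016, Thm. 3.5] -/
def rotorRealBond (J : ℝ) (b : Λ → ℝ) (x y : Λ) : Op Λ (2 * M + 1) :=
  -((J : ℂ) • cosBond M x y) + (J : ℂ) • sinBond M x y -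
    ((J * (b x - b y) : ℝ) : ℂ) • (siteCos M x - siteCos M y) +
    ((J * (b x - b y) ^ 2 / 2 : ℝ) : ℂ) • 1

/-- The rotated bond term is symmetric in the two sites. [folklore] -/
theorem rotorRealBond_comm (J : ℝ) (b : Λ → ℝ) (x y : Λ) :
    rotorRealBond M J b x y = rotorRealBond M J b y x := by
  simp only [rotorRealBond, cosBond_comm M x y, sinBond_comm M x y]
  congr 2
  · rw [← neg_sub (b y) (b x), mul_neg, Complex.ofReal_neg, neg_smul, ← smul_neg, neg_sub]
  · rw [← neg_sub (b y) (b x), neg_sq]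

/-- The rotated bond term depends on the field only through its values at the two sites.
[folklore] -/
theorem rotorRealBond_congr (J : ℝ) {b₁ b₂ : Λ → ℝ} {x y : Λ} (hx : b₁ x = b₂ x)
    (hy : b₁ y = b₂ y) : rotorRealBond M J b₁ x y = rotorRealBond M J b₂ x y := by
  simp only [rotorRealBond, hx, hy]

/-- The rotated bond term is Hermitian. [folklore] -/
theorem rotorRealBond_isHermitian (J : ℝ) (b : Λ → ℝ) (x y : Λ) :
    (rotorRealBond M J b x y).IsHermitian := by
  unfold rotorRealBond
  have hr : ∀ r : ℝ, IsSelfAdjoint (r : ℂ) := fun r => by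
    rw [isSelfAdjoint_iff, Complex.star_def, Complex.conj_ofReal]
  refine ((((cosBond_isHermitian M x y).smul (hr J)).neg.add
    ((sinBond_isHermitian M x y).smul (hr J))).sub
    (((siteCos_isHermitian M x).sub (siteCos_isHermitian M y)).smul (hr _))).add
    (isHermitian_one.smul (hr _))

/-! #### Reality -/

/-- `cos_x` is a real matrix. [folklore] -/
theorem siteCos_transpose_eq (x : Λ) : (siteCos M x : Op Λ (2 * M + 1))ᵀ = (siteCos M x)ᴴ :=
  transpose_eq_conjTranspose_onSite x (truncCos_transpose_eq_conjTranspose M)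

/-- `i·sin_x` is a real matrix. [folklore] -/
theorem I_smul_siteSin_transpose_eq (x : Λ) :
    (I • (siteSin M x : Op Λ (2 * M + 1)))ᵀ = (I • siteSin M x)ᴴ := by
  rw [siteSin, ← onSite_smul']
  exact transpose_eq_conjTranspose_onSite x (I_smul_truncSin_transpose_eq_conjTranspose M)

/-- `N_x²` is a real matrix. [folklore] -/
theorem siteMomentumSq_transpose_eq (x : Λ) :
    (siteMomentumSq M x : Op Λ (2 * M + 1))ᵀ = (siteMomentumSq M x)ᴴ := by
  refine transpose_eq_conjTranspose_onSite x ?_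
  rw [transpose_mul, truncMomentum_transpose, conjTranspose_mul, (truncMomentum_isHermitian M).eq]

/-- `sin_x sin_y = -(i sin_x)(i sin_y)` is a real matrix. [folklore] -/
theorem siteSin_mul_transpose_eq (x y : Λ) :
    ((siteSin M x : Op Λ (2 * M + 1)) * siteSin M y)ᵀ = (siteSin M x * siteSin M y)ᴴ := by
  have h : (siteSin M x : Op Λ (2 * M + 1)) * siteSin M y =
      -((I • siteSin M x) * (I • siteSin M y)) := by
    rw [smul_mul_smul_comm, Complex.I_mul_I, neg_smul, one_smul, neg_neg]
  rw [h]
  exact transpose_eq_conjTranspose_neg (transpose_eq_conjTranspose_mul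
    (I_smul_siteSin_transpose_eq M x) (I_smul_siteSin_transpose_eq M y))

/-- The rotated bond term is a real matrix. [cite: KLS1988JSP, after eq. (17)] -/
theorem rotorRealBond_transpose_eq (J : ℝ) (b : Λ → ℝ) (x y : Λ) :
    (rotorRealBond M J b x y)ᵀ = (rotorRealBond M J b x y)ᴴ := by
  unfold rotorRealBond cosBond sinBond
  have h0x := siteCos_transpose_eq (Λ := Λ) M x
  have h0y := siteCos_transpose_eq (Λ := Λ) M y
  refine transpose_eq_conjTranspose_add (transpose_eq_conjTranspose_sub
    (transpose_eq_conjTranspose_add (transpose_eq_conjTranspose_neg ?_) ?_) ?_) ?_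
  · refine transpose_eq_conjTranspose_ofReal_smul ?_ _
    rw [show (1 / 2 : ℂ) = ((1 / 2 : ℝ) : ℂ) by push_cast; ring]
    exact transpose_eq_conjTranspose_ofReal_smul (transpose_eq_conjTranspose_add
      (transpose_eq_conjTranspose_mul h0x h0y) (transpose_eq_conjTranspose_mul h0y h0x)) _
  · refine transpose_eq_conjTranspose_ofReal_smul ?_ _
    rw [show (1 / 2 : ℂ) = ((1 / 2 : ℝ) : ℂ) by push_cast; ring]
    exact transpose_eq_conjTranspose_ofReal_smul (transpose_eq_conjTranspose_add
      (siteSin_mul_transpose_eq M x y) (siteSin_mul_transpose_eq M y x)) _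
  · exact transpose_eq_conjTranspose_ofReal_smul (transpose_eq_conjTranspose_sub h0x h0y) _
  · exact transpose_eq_conjTranspose_ofReal_smul transpose_eq_conjTranspose_one _

end Defs

/-! ### The field Hamiltonians on the torus -/

section TorusDefs

variable (L : ℕ) [NeZero L] (M : ℕ)

/-- The field term `V_b = Σ_x Σᵢ (b_x - b_{x+eᵢ})(cos_x - cos_{x+eᵢ})` (sum over the bonds
`(x, x + eᵢ)`; the cross term of the completed square). [cite: KLS1988JSP, eq. (17)] -/
def rotorGradField (b : TorusSite d L → ℝ) : Op (TorusSite d L) (2 * M + 1) :=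
  ∑ x : TorusSite d L, ∑ i : Fin d,
    ((b x - b (x + Pi.single i 1) : ℝ) : ℂ) • (siteCos M x - siteCos M (x + Pi.single i 1))

/-- The field-dependent rotator Hamiltonian
`H_M(b) = H_M - J V_b + ½J Σ_x Σᵢ (b_x - b_{x+eᵢ})²` (`H_M(0) = H_M`; the field energy is the
tree's `xyFieldEnergy`). [cite: WojtkiewiczPuszStachura2016, Thm. 3.5]
[cite: KLS1988JSP, eq. (17)] -/
def rotorFieldHamiltonian (h J : ℝ) (b : TorusSite d L → ℝ) : Op (TorusSite d L) (2 * M + 1) :=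
  truncHamiltonian M (torusGraph d L).Adj h J - (J : ℂ) • rotorGradField L M b +
    ((J * xyFieldEnergy L b / 2 : ℝ) : ℂ) • 1

/-- The rotated field Hamiltonian `H♭(b) = Σ_x (h/2)N_x² + Σ_{⟨xy⟩} τ_b(x, y)` (sum over the edges
of the torus graph); unitarily equivalent to `H_M(b)` for even `L ≥ 4`, and real in the momentum
basis. [cite: KLS1988JSP, eqs. (16)–(17)] -/
def rotorRealFieldHamiltonian (h J : ℝ) (b : TorusSite d L → ℝ) :
    Op (TorusSite d L) (2 * M + 1) :=
  ∑ x : TorusSite d L, ((h / 2 : ℝ) : ℂ) • siteMomentumSq M x +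
    ∑ e ∈ (torusGraph d L).edgeFinset,
      Sym2.lift ⟨fun x y => rotorRealBond M J b x y, fun x y => rotorRealBond_comm M J b x y⟩ e

variable (j : Fin d) (a : ZMod L)

/-- **The left Hamiltonian `H^L`** on the left half: the kinetic terms of the left sites, the
rotated bond terms of the left bonds, and the on-site terms `½J b_x² - J b_x cos_x` of the left
endpoints of the crossing bonds. [cite: KLS1988JSP, eq. (21)] -/
def rotorLeftHamiltonian (hL : Even L) (h J : ℝ) (b : TorusSite d L → ℝ) :
    Op (torusLeftHalf L j a) (2 * M + 1) :=
  ∑ s : torusLeftHalf L j a, ((h / 2 : ℝ) : ℂ) • siteMomentumSq M s +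
  (∑ e ∈ torusLeftEdges L j a,
    Sym2.lift ⟨fun x y => rotorRealBond M J (fun z : torusLeftHalf L j a => b z)
        (torusToLeft L j a hL x) (torusToLeft L j a hL y), fun _ _ =>
      rotorRealBond_comm M J _ _ _⟩ e) +
  ∑ x ∈ torusCrossSites L j a,
    (((J * (b x) ^ 2 / 2 : ℝ) : ℂ) • (1 : Op (torusLeftHalf L j a) (2 * M + 1)) -
      ((J * b x : ℝ) : ℂ) • siteCos M (torusToLeft L j a hL x))

/-- **The crossing operators** `Mᵢ` of the Kronecker form: for a left endpoint `x` of a crossing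
bond, `M_{(x,0)} = √J (cos_x - b_x)` and `M_{(x,1)} = √J · i sin_x` (real matrices; `J ≥ 0`).
[cite: KLS1988JSP, eq. (21)] -/
def rotorCrossOp (hL : Even L) (J : ℝ) (b : TorusSite d L → ℝ) :
    torusCrossSites L j a × Bool → Op (torusLeftHalf L j a) (2 * M + 1)
  | (x, false) => ((Real.sqrt J : ℝ) : ℂ) •
      (siteCos M (torusToLeft L j a hL x) - ((b x : ℝ) : ℂ) • (1 : Op (torusLeftHalf L j a) (2 * M + 1)))
  | (x, true) => ((Real.sqrt J : ℝ) : ℂ) • (I • siteSin M (torusToLeft L j a hL x))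

end TorusDefs

/-! ### The tensor-square identification: site operators, bonds, crossing bonds -/

section Embeddings

variable {L : ℕ} [NeZero L] {j : Fin d} {a : ZMod L} (M : ℕ) {hL : Even L}

/-- Single-site operators of the left half are `c ⊗ 1`. [folklore] -/
theorem onSite_eq_torusLeftEmbed {q : ℕ} {x : TorusSite d L} (hx : x ∈ torusLeftHalf L j a)
    (c : Matrix (Fin q) (Fin q) ℂ) :
    (onSite x c : Op (TorusSite d L) q) =
      torusLeftEmbed L j a hL (onSite (torusToLeft L j a hL x) c) := by
  rw [torusLeftEmbed_apply]
  exact onSite_eq_submatrix_kronecker_of_mem L j a hL hx _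

/-- Single-site operators of the right half are `1 ⊗ c`. [folklore] -/
theorem onSite_eq_torusRightEmbed {q : ℕ} {z : TorusSite d L} (hz : z ∉ torusLeftHalf L j a)
    (c : Matrix (Fin q) (Fin q) ℂ) :
    (onSite z c : Op (TorusSite d L) q) =
      torusRightEmbed L j a hL (onSite (torusToLeft L j a hL z) c) := by
  rw [torusRightEmbed_apply]
  exact onSite_eq_submatrix_kronecker_of_not_mem L j a hL hz _

/-- `cos_x = cos ⊗ 1` for a left site. [folklore] -/
theorem siteCos_eq_torusLeftEmbed {x : TorusSite d L} (hx : x ∈ torusLeftHalf L j a) :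
    (siteCos M x : Op (TorusSite d L) (2 * M + 1)) =
      torusLeftEmbed L j a hL (siteCos M (torusToLeft L j a hL x)) :=
  onSite_eq_torusLeftEmbed hx _

/-- `sin_x = sin ⊗ 1` for a left site. [folklore] -/
theorem siteSin_eq_torusLeftEmbed {x : TorusSite d L} (hx : x ∈ torusLeftHalf L j a) :
    (siteSin M x : Op (TorusSite d L) (2 * M + 1)) =
      torusLeftEmbed L j a hL (siteSin M (torusToLeft L j a hL x)) :=
  onSite_eq_torusLeftEmbed hx _

/-- `N_x² = N² ⊗ 1` for a left site. [folklore] -/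
theorem siteMomentumSq_eq_torusLeftEmbed {x : TorusSite d L} (hx : x ∈ torusLeftHalf L j a) :
    (siteMomentumSq M x : Op (TorusSite d L) (2 * M + 1)) =
      torusLeftEmbed L j a hL (siteMomentumSq M (torusToLeft L j a hL x)) :=
  onSite_eq_torusLeftEmbed hx _

/-- `cos_z = 1 ⊗ cos` for a right site. [folklore] -/
theorem siteCos_eq_torusRightEmbed {z : TorusSite d L} (hz : z ∉ torusLeftHalf L j a) :
    (siteCos M z : Op (TorusSite d L) (2 * M + 1)) =
      torusRightEmbed L j a hL (siteCos M (torusToLeft L j a hL z)) :=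
  onSite_eq_torusRightEmbed hz _

/-- `sin_z = 1 ⊗ sin` for a right site. [folklore] -/
theorem siteSin_eq_torusRightEmbed {z : TorusSite d L} (hz : z ∉ torusLeftHalf L j a) :
    (siteSin M z : Op (TorusSite d L) (2 * M + 1)) =
      torusRightEmbed L j a hL (siteSin M (torusToLeft L j a hL z)) :=
  onSite_eq_torusRightEmbed hz _

/-- `N_z² = 1 ⊗ N²` for a right site. [folklore] -/
theorem siteMomentumSq_eq_torusRightEmbed {z : TorusSite d L} (hz : z ∉ torusLeftHalf L j a) :
    (siteMomentumSq M z : Op (TorusSite d L) (2 * M + 1)) =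
      torusRightEmbed L j a hL (siteMomentumSq M (torusToLeft L j a hL z)) :=
  onSite_eq_torusRightEmbed hz _

/-- Pushing an algebra homomorphism through the rotated bond term. [folklore] -/
theorem map_rotorRealBond {Λ Λ' : Type*} [Fintype Λ] [DecidableEq Λ] [Fintype Λ'] [DecidableEq Λ']
    (φ : Op Λ (2 * M + 1) →ₐ[ℂ] Op Λ' (2 * M + 1)) (J : ℝ) (b : Λ → ℝ) (x y : Λ) :
    φ (rotorRealBond M J b x y) =
      -((J : ℂ) • ((1 / 2 : ℂ) • (φ (siteCos M x) * φ (siteCos M y) +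
          φ (siteCos M y) * φ (siteCos M x)))) +
        (J : ℂ) • ((1 / 2 : ℂ) • (φ (siteSin M x) * φ (siteSin M y) +
          φ (siteSin M y) * φ (siteSin M x))) -
        ((J * (b x - b y) : ℝ) : ℂ) • (φ (siteCos M x) - φ (siteCos M y)) +
        ((J * (b x - b y) ^ 2 / 2 : ℝ) : ℂ) • 1 := by
  simp only [rotorRealBond, cosBond, sinBond, map_add, map_sub, map_neg, map_smul, map_mul, map_one]

/-- **Left bonds are `τ ⊗ 1`.** [cite: KLS1988JSP, eq. (21)] -/
theorem rotorRealBond_eq_torusLeftEmbed (J : ℝ) (b : TorusSite d L → ℝ) {x y : TorusSite d L}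
    (hx : x ∈ torusLeftHalf L j a) (hy : y ∈ torusLeftHalf L j a) :
    rotorRealBond M J b x y = torusLeftEmbed L j a hL
      (rotorRealBond M J (fun s : torusLeftHalf L j a => b s)
        (torusToLeft L j a hL x) (torusToLeft L j a hL y)) := by
  rw [map_rotorRealBond, ← siteCos_eq_torusLeftEmbed M hx, ← siteCos_eq_torusLeftEmbed M hy,
    ← siteSin_eq_torusLeftEmbed M hx, ← siteSin_eq_torusLeftEmbed M hy,
    torusToLeft_val_of_mem L j a hL hx, torusToLeft_val_of_mem L j a hL hy]
  rfl

/-- **Right bonds are `1 ⊗ τ`** (with the reflected field). [cite: KLS1988JSP, eq. (21)] -/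
theorem rotorRealBond_eq_torusRightEmbed (J : ℝ) (b : TorusSite d L → ℝ) {z w : TorusSite d L}
    (hz : z ∉ torusLeftHalf L j a) (hw : w ∉ torusLeftHalf L j a) :
    rotorRealBond M J b z w = torusRightEmbed L j a hL
      (rotorRealBond M J (fun s : torusLeftHalf L j a => b (Torus.reflectBetweenSites j a s))
        (torusToLeft L j a hL z) (torusToLeft L j a hL w)) := by
  rw [map_rotorRealBond, ← siteCos_eq_torusRightEmbed M hz, ← siteCos_eq_torusRightEmbed M hw,
    ← siteSin_eq_torusRightEmbed M hz, ← siteSin_eq_torusRightEmbed M hw,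
    torusToLeft_of_not_mem L j a hL hz, torusToLeft_of_not_mem L j a hL hw]
  simp only [reflectBetweenSites_reflectBetweenSites]
  rfl

/-- **Crossing bonds** (eq. (20) of [KLS1988JSP], rotator version): for a left endpoint `x` of a
crossing bond `{x, θx}` and `J ≥ 0`,
`τ_b(x, θx) = (½J b_x² - J b_x cos_x) ⊗ 1 + 1 ⊗ (½J b_{θx}² - J b_{θx} cos_x)
  - (√J(cos_x - b_x)) ⊗ (√J(cos_x - b_{θx})) - (√J i sin_x) ⊗ (√J i sin_x)`.
[cite: KLS1988JSP, eqs. (20)–(21)] -/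
theorem rotorRealBond_cross {J : ℝ} (hJ : 0 ≤ J) (b : TorusSite d L → ℝ)
    (x : torusCrossSites L j a) :
    rotorRealBond M J b x (Torus.reflectBetweenSites j a x) =
      torusLeftEmbed L j a hL (((J * (b x) ^ 2 / 2 : ℝ) : ℂ) • 1 -
          ((J * b x : ℝ) : ℂ) • siteCos M (torusToLeft L j a hL x)) +
        torusRightEmbed L j a hL
          (((J * (b (Torus.reflectBetweenSites j a x)) ^ 2 / 2 : ℝ) : ℂ) • 1 -
            ((J * b (Torus.reflectBetweenSites j a x) : ℝ) : ℂ) •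
              siteCos M (torusToLeft L j a hL x)) -
        (torusLeftEmbed L j a hL (rotorCrossOp L M j a hL J b (x, true)) *
            torusRightEmbed L j a hL
              (rotorCrossOp L M j a hL J (fun y => b (Torus.reflectBetweenSites j a y)) (x, true)) +
          torusLeftEmbed L j a hL (rotorCrossOp L M j a hL J b (x, false)) *
            torusRightEmbed L j a hL
              (rotorCrossOp L M j a hL J (fun y => b (Torus.reflectBetweenSites j a y))
                (x, false))) := by
  have hx : (x : TorusSite d L) ∈ torusLeftHalf L j a := (mem_torusCrossSites.1 x.2).1
  have hθ : Torus.reflectBetweenSites j a x ∉ torusLeftHalf L j a := fun h =>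
    (reflectBetweenSites_mem_torusLeftHalf_iff L j a hL (x : TorusSite d L)).1 h hx
  have e0 : (siteCos M (x : TorusSite d L) : Op (TorusSite d L) (2 * M + 1)) =
      torusLeftEmbed L j a hL (siteCos M (torusToLeft L j a hL x)) :=
    siteCos_eq_torusLeftEmbed M hx
  have e1 : (siteSin M (x : TorusSite d L) : Op (TorusSite d L) (2 * M + 1)) =
      torusLeftEmbed L j a hL (siteSin M (torusToLeft L j a hL x)) :=
    siteSin_eq_torusLeftEmbed M hx
  have e2 : (siteCos M (Torus.reflectBetweenSites j a x) : Op (TorusSite d L) (2 * M + 1)) =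
      torusRightEmbed L j a hL (siteCos M (torusToLeft L j a hL x)) := by
    rw [siteCos_eq_torusRightEmbed M hθ, torusToLeft_reflectBetweenSites]
  have e3 : (siteSin M (Torus.reflectBetweenSites j a x) : Op (TorusSite d L) (2 * M + 1)) =
      torusRightEmbed L j a hL (siteSin M (torusToLeft L j a hL x)) := by
    rw [siteSin_eq_torusRightEmbed M hθ, torusToLeft_reflectBetweenSites]
  have hsq : ((Real.sqrt J : ℝ) : ℂ) * (Real.sqrt J : ℂ) = (J : ℂ) := by
    rw [← Complex.ofReal_mul, Real.mul_self_sqrt hJ]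
  have hII : ((Real.sqrt J : ℝ) : ℂ) * I * ((Real.sqrt J : ℂ) * I) = -(J : ℂ) := by
    rw [mul_mul_mul_comm, hsq, Complex.I_mul_I, mul_neg, mul_one]
  -- atoms
  set X : Op (torusLeftHalf L j a) (2 * M + 1) := siteCos M (torusToLeft L j a hL x) with hX
  set Y : Op (torusLeftHalf L j a) (2 * M + 1) := siteSin M (torusToLeft L j a hL x) with hY
  clear_value X Y
  have hPX : torusLeftEmbed L j a hL X * torusRightEmbed L j a hL X =
      torusRightEmbed L j a hL X * torusLeftEmbed L j a hL X := by
    rw [torusLeftEmbed_mul_torusRightEmbed, torusRightEmbed_mul_torusLeftEmbed]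
  have hPY : torusLeftEmbed L j a hL Y * torusRightEmbed L j a hL Y =
      torusRightEmbed L j a hL Y * torusLeftEmbed L j a hL Y := by
    rw [torusLeftEmbed_mul_torusRightEmbed, torusRightEmbed_mul_torusLeftEmbed]
  -- the two crossing products, with `√J · √J = J` taken care of
  have hcT : torusLeftEmbed L j a hL (rotorCrossOp L M j a hL J b (x, true)) *
      torusRightEmbed L j a hL
        (rotorCrossOp L M j a hL J (fun y => b (Torus.reflectBetweenSites j a y)) (x, true)) =
      (-(J : ℂ)) • (torusLeftEmbed L j a hL Y * torusRightEmbed L j a hL Y) := by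
    simp only [rotorCrossOp, smul_smul, ← hY, map_smul, smul_mul_smul_comm, hII]
  have hcF : torusLeftEmbed L j a hL (rotorCrossOp L M j a hL J b (x, false)) *
      torusRightEmbed L j a hL
        (rotorCrossOp L M j a hL J (fun y => b (Torus.reflectBetweenSites j a y)) (x, false)) =
      (J : ℂ) • (torusLeftEmbed L j a hL (X - ((b x : ℝ) : ℂ) • 1) *
        torusRightEmbed L j a hL (X - ((b (Torus.reflectBetweenSites j a x) : ℝ) : ℂ) • 1)) := by
    simp only [rotorCrossOp, ← hX, map_smul, smul_mul_smul_comm, hsq]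
  rw [hcT, hcF]
  simp only [rotorRealBond, cosBond, sinBond, map_sub, map_smul, map_one]
  simp only [e0, e1, e2, e3]
  simp only [mul_sub, sub_mul, smul_mul_assoc, mul_smul_comm, Matrix.one_mul, Matrix.mul_one,
    smul_sub, smul_smul]
  rw [← hPX, ← hPY]
  push_cast
  module

end Embeddings

/-! ### The Kronecker form of the rotated field Hamiltonian -/

section KroneckerForm

variable (L : ℕ) [NeZero L] (M : ℕ) (j : Fin d) (a : ZMod L) (hL : Even L)

include hL in
/-- Sums over the right half, reindexed over the left half along `θ`. [folklore] -/
theorem sum_filter_not_mem_torusLeftHalf {β : Type*} [AddCommMonoid β] (f : TorusSite d L → β) :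
    ∑ x ∈ univ.filter (fun x => x ∉ torusLeftHalf L j a), f x =
      ∑ s : torusLeftHalf L j a, f (Torus.reflectBetweenSites j a s) := by
  refine Finset.sum_bij' (fun x hx => ⟨Torus.reflectBetweenSites j a x,
      (reflectBetweenSites_mem_torusLeftHalf_iff L j a hL x).2 (mem_filter.1 hx).2⟩)
    (fun s _ => Torus.reflectBetweenSites j a s) (fun x hx => mem_univ _) (fun s _ => ?_)
    (fun x hx => ?_) (fun s _ => ?_) (fun x hx => ?_)
  · exact mem_filter.2 ⟨mem_univ _, fun h =>
      (reflectBetweenSites_mem_torusLeftHalf_iff L j a hL (s : TorusSite d L)).1 h s.2⟩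
  · exact reflectBetweenSites_reflectBetweenSites L j a x
  · exact Subtype.ext (reflectBetweenSites_reflectBetweenSites L j a (s : TorusSite d L))
  · simp only [reflectBetweenSites_reflectBetweenSites]

/-- **The kinetic energy splits between the halves**: `Σ_x c N_x² = (Σ_{s ∈ left} c N_s²) ⊗ 1 +
1 ⊗ (Σ_{s ∈ left} c N_s²)`. [folklore] -/
theorem sum_siteMomentumSq_eq_embed (c : ℂ) :
    ∑ x : TorusSite d L, c • (siteMomentumSq M x : Op (TorusSite d L) (2 * M + 1)) =
      torusLeftEmbed L j a hL (∑ s : torusLeftHalf L j a, c • siteMomentumSq M s) +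
        torusRightEmbed L j a hL (∑ s : torusLeftHalf L j a, c • siteMomentumSq M s) := by
  rw [map_sum, map_sum,
    ← Finset.sum_filter_add_sum_filter_not univ (fun x => x ∈ torusLeftHalf L j a)]
  congr 1
  · rw [Finset.filter_mem_eq_inter, Finset.univ_inter, ← Finset.sum_coe_sort]
    refine sum_congr rfl fun s _ => ?_
    rw [map_smul, siteMomentumSq_eq_torusLeftEmbed M s.2, torusToLeft_of_mem L j a hL s.2]
  · rw [sum_filter_not_mem_torusLeftHalf L j a hL]
    refine sum_congr rfl fun s _ => ?_
    have hs : Torus.reflectBetweenSites j a s ∉ torusLeftHalf L j a := fun h =>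
      (reflectBetweenSites_mem_torusLeftHalf_iff L j a hL (s : TorusSite d L)).1 h s.2
    rw [map_smul, siteMomentumSq_eq_torusRightEmbed M hs, torusToLeft_reflectBetweenSites,
      torusToLeft_of_mem L j a hL s.2]

/-- **The Kronecker form of the rotated field Hamiltonian** ([KLS1988JSP] eq. (21)): under the
tensor-square identification along `θ`, for `J ≥ 0`,
`H♭(b) = H^L(b) ⊗ 1 + 1 ⊗ H^L(b ∘ θ) - Σᵢ Mᵢ(b) ⊗ Mᵢ(b ∘ θ)`. [cite: KLS1988JSP, eq. (21)] -/
theorem rotorRealFieldHamiltonian_eq_submatrix (h : ℝ) {J : ℝ} (hJ : 0 ≤ J)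
    (b : TorusSite d L → ℝ) :
    rotorRealFieldHamiltonian L M h J b =
      (rotorLeftHamiltonian L M j a hL h J b ⊗ₖ (1 : Op (torusLeftHalf L j a) (2 * M + 1)) +
          (1 : Op (torusLeftHalf L j a) (2 * M + 1)) ⊗ₖ
            rotorLeftHamiltonian L M j a hL h J (fun y => b (Torus.reflectBetweenSites j a y)) -
          ∑ i, rotorCrossOp L M j a hL J b i ⊗ₖ
            rotorCrossOp L M j a hL J (fun y => b (Torus.reflectBetweenSites j a y)) i).submatrix
        (torusSplit L j a hL) (torusSplit L j a hL) := by
  rw [submatrix_kroneckerForm, rotorRealFieldHamiltonian, sum_edgeFinset_split L j a hL]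
  -- names for the three half-space summands
  set TL : Sym2 (TorusSite d L) → Op (torusLeftHalf L j a) (2 * M + 1) := fun e =>
    Sym2.lift ⟨fun x y => rotorRealBond M J (fun z : torusLeftHalf L j a => b z)
      (torusToLeft L j a hL x) (torusToLeft L j a hL y),
      fun x y => rotorRealBond_comm M J _ _ _⟩ e with hTL
  set TR : Sym2 (TorusSite d L) → Op (torusLeftHalf L j a) (2 * M + 1) := fun e =>
    Sym2.lift ⟨fun x y => rotorRealBond M J
      (fun z : torusLeftHalf L j a => b (Torus.reflectBetweenSites j a z))
      (torusToLeft L j a hL x) (torusToLeft L j a hL y),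
      fun x y => rotorRealBond_comm M J _ _ _⟩ e with hTR
  -- (0) kinetic terms
  have h0 := sum_siteMomentumSq_eq_embed L M j a hL (((h / 2 : ℝ) : ℂ))
  -- (1) left bonds
  have h1 : ∑ e ∈ torusLeftEdges L j a,
      Sym2.lift ⟨fun x y => rotorRealBond M J b x y, fun x y => rotorRealBond_comm M J b x y⟩ e =
        torusLeftEmbed L j a hL (∑ e ∈ torusLeftEdges L j a, TL e) := by
    rw [map_sum]
    refine sum_congr rfl fun e he => ?_
    obtain ⟨-, hl⟩ := mem_filter.1 he
    revert hl
    refine Sym2.ind (fun x y => ?_) e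
    intro hl
    simp only [hTL, Sym2.lift_mk]
    exact rotorRealBond_eq_torusLeftEmbed M J b (hl x (Sym2.mem_mk_left x y))
      (hl y (Sym2.mem_mk_right x y))
  -- (2) right bonds
  have h2 : ∑ e ∈ ((torusGraph d L).edgeFinset.filter fun e => ∀ x ∈ e, x ∉ torusLeftHalf L j a),
      Sym2.lift ⟨fun x y => rotorRealBond M J b x y, fun x y => rotorRealBond_comm M J b x y⟩ e =
        torusRightEmbed L j a hL (∑ e ∈ torusLeftEdges L j a, TR e) := by
    rw [← sum_rightEdges_eq_sum_leftEdges L j a hL TR, map_sum]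
    · refine sum_congr rfl fun e he => ?_
      obtain ⟨-, hr⟩ := mem_filter.1 he
      revert hr
      refine Sym2.ind (fun x y => ?_) e
      intro hr
      simp only [hTR, Sym2.lift_mk]
      exact rotorRealBond_eq_torusRightEmbed M J b (hr x (Sym2.mem_mk_left x y))
        (hr y (Sym2.mem_mk_right x y))
    · intro e
      refine Sym2.ind (fun x y => ?_) e
      simp only [hTR, Sym2.map_mk, Sym2.lift_mk, torusToLeft_reflectBetweenSites]
  -- (3) crossing bonds
  have h3 : ∑ x ∈ torusCrossSites L j a,
      Sym2.lift ⟨fun x y => rotorRealBond M J b x y, fun x y => rotorRealBond_comm M J b x y⟩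
        s(x, Torus.reflectBetweenSites j a x) =
      torusLeftEmbed L j a hL (∑ x ∈ torusCrossSites L j a,
          (((J * (b x) ^ 2 / 2 : ℝ) : ℂ) • (1 : Op (torusLeftHalf L j a) (2 * M + 1)) -
            ((J * b x : ℝ) : ℂ) • siteCos M (torusToLeft L j a hL x))) +
        torusRightEmbed L j a hL (∑ x ∈ torusCrossSites L j a,
          (((J * (b (Torus.reflectBetweenSites j a x)) ^ 2 / 2 : ℝ) : ℂ) •
              (1 : Op (torusLeftHalf L j a) (2 * M + 1)) -
            ((J * b (Torus.reflectBetweenSites j a x) : ℝ) : ℂ) •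
              siteCos M (torusToLeft L j a hL x))) -
        ∑ i : torusCrossSites L j a × Bool, torusLeftEmbed L j a hL (rotorCrossOp L M j a hL J b i) *
          torusRightEmbed L j a hL
            (rotorCrossOp L M j a hL J (fun y => b (Torus.reflectBetweenSites j a y)) i) := by
    rw [map_sum, map_sum, Fintype.sum_prod_type]
    simp only [Fintype.sum_bool]
    rw [← Finset.sum_coe_sort (torusCrossSites L j a), ← Finset.sum_coe_sort (torusCrossSites L j a),
      ← Finset.sum_coe_sort (torusCrossSites L j a), ← sum_add_distrib, ← sum_sub_distrib]
    refine sum_congr rfl fun x _ => ?_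
    rw [Sym2.lift_mk]
    exact rotorRealBond_cross M hJ b x
  rw [h0, h1, h2, h3, rotorLeftHamiltonian, rotorLeftHamiltonian, map_add, map_add, map_add, map_add]
  abel

end KroneckerForm

/-! ### The momentum flip on the odd sublattice: `H_M(b)` is unitarily equivalent to `H♭(b)` -/

section Rotation

variable (L : ℕ) [NeZero L] (M : ℕ)

/-- **The neighbours of a site of the torus** (`L ≥ 3`): `y ∼ x` iff `y = x ± eᵢ`, the `2d`
sites being distinct; sums over neighbours. [folklore] -/
theorem sum_filter_torusGraph_adj (hL : 3 ≤ L) {β : Type*} [AddCommMonoid β] (x : TorusSite d L)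
    (f : TorusSite d L → β) :
    ∑ y ∈ univ.filter ((torusGraph d L).Adj x), f y =
      ∑ i : Fin d, f (x + Pi.single i 1) + ∑ i : Fin d, f (x - Pi.single i 1) := by
  have hL2 : 2 ≤ L := by omega
  have hset : univ.filter ((torusGraph d L).Adj x) =
      (univ.image fun i : Fin d => x + Pi.single i 1) ∪
        (univ.image fun i : Fin d => x - Pi.single i 1) := by
    ext y
    simp only [mem_filter, mem_univ, true_and, mem_union, mem_image]
    rw [torusGraph_adj_iff]
    constructor
    · rintro ⟨-, ⟨i, rfl⟩ | ⟨i, hi⟩⟩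
      · exact Or.inl ⟨i, rfl⟩
      · exact Or.inr ⟨i, by rw [hi, add_sub_cancel_right]⟩
    · rintro (⟨i, rfl⟩ | ⟨i, rfl⟩)
      · refine ⟨fun h => torus_single_ne_zero hL2 i ?_, Or.inl ⟨i, rfl⟩⟩
        have h' := congrArg (· - x) h
        simpa using h'.symm
      · refine ⟨fun h => torus_single_ne_zero hL2 i ?_, Or.inr ⟨i, by rw [sub_add_cancel]⟩⟩
        have h' := congrArg (fun z => x - z) h
        simp only [sub_sub_cancel, sub_self] at h'
        exact h'.symm
  have hdisj : Disjoint (univ.image fun i : Fin d => x + Pi.single i 1)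
      (univ.image fun i : Fin d => x - Pi.single i 1) := by
    rw [Finset.disjoint_left]
    intro y h1 h2
    obtain ⟨i, -, rfl⟩ := mem_image.1 h1
    obtain ⟨k, -, hk⟩ := mem_image.1 h2
    refine torus_single_add_single_ne_zero hL i k ?_
    have h' := congrArg (fun z => z - x + Pi.single k 1) hk
    simp only [sub_sub_cancel_left, neg_add_cancel, add_sub_cancel_left] at h'
    exact h'.symm
  rw [hset, sum_union hdisj,
    sum_image (fun i _ k _ h => torus_single_injective hL2 (add_left_cancel h)),
    sum_image (fun i _ k _ h => torus_single_injective hL2 (sub_right_inj.1 h))]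

/-- **Double sums over neighbours versus sums over bonds** (`L ≥ 3`): for a summand symmetric in
the two sites, `Σ_x Σ_{y ∼ x} f(x, y) = 2 Σ_x Σᵢ f(x, x + eᵢ)` (every bond twice). [folklore] -/
theorem sum_sum_filter_torusGraph_adj (hL : 3 ≤ L) {β : Type*} [AddCommMonoid β]
    (f : TorusSite d L → TorusSite d L → β) (hf : ∀ x y, f x y = f y x) :
    ∑ x : TorusSite d L, ∑ y ∈ univ.filter ((torusGraph d L).Adj x), f x y =
      ∑ x : TorusSite d L, ∑ i : Fin d, f x (x + Pi.single i 1) +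
        ∑ x : TorusSite d L, ∑ i : Fin d, f x (x + Pi.single i 1) := by
  simp_rw [sum_filter_torusGraph_adj L hL]
  rw [sum_add_distrib]
  congr 1
  rw [Finset.sum_comm, Finset.sum_comm (s := (univ : Finset (TorusSite d L)))]
  refine sum_congr rfl fun i _ => ?_
  rw [← Equiv.sum_comp (Equiv.addRight (Pi.single i (1 : ZMod L) : TorusSite d L))]
  refine sum_congr rfl fun x _ => ?_
  simp only [Equiv.coe_addRight, add_sub_cancel_right]
  exact hf _ _

/-- **The compressed Hamiltonian as a sum over bonds**: for `L ≥ 3`,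
`H_M = Σ_x (h/2)N_x² - J Σ_{⟨xy⟩} truncBond`, `⟨xy⟩` running over the bonds `(x, x + eᵢ)`.
[cite: WojtkiewiczPuszStachura2016, §3.1 (HamRot)] -/
theorem truncHamiltonian_torus_eq (hL : 3 ≤ L) (h J : ℝ) :
    truncHamiltonian M (torusGraph d L).Adj h J =
      ∑ x : TorusSite d L, ((h / 2 : ℝ) : ℂ) • siteMomentumSq M x -
        ∑ x : TorusSite d L, ∑ i : Fin d, (J : ℂ) • truncBond M x (x + Pi.single i 1) := by
  rw [truncHamiltonian, sum_sum_filter_torusGraph_adj L hL _ (fun x y => by rw [truncBond_comm]),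
    ← sum_add_distrib]
  congr 1
  refine sum_congr rfl fun x _ => ?_
  rw [← sum_add_distrib]
  refine sum_congr rfl fun i _ => ?_
  rw [← add_smul, ← Complex.ofReal_add, add_halves]

/-- **The field Hamiltonian as a sum over bonds**: for `L ≥ 3`,
`H_M(b) = Σ_x (h/2)N_x² + Σ_{⟨xy⟩} [-J cosBond - J sinBond - J(b_x - b_y)(cos_x - cos_y) + ½J(b_x - b_y)²]`.
[cite: KLS1988JSP, eq. (17)] -/
theorem rotorFieldHamiltonian_eq_edgeSum (hL : 3 ≤ L) (h J : ℝ) (b : TorusSite d L → ℝ) :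
    rotorFieldHamiltonian L M h J b = ∑ x : TorusSite d L, ((h / 2 : ℝ) : ℂ) • siteMomentumSq M x +
      ∑ e ∈ (torusGraph d L).edgeFinset,
        Sym2.lift ⟨fun x y => -((J : ℂ) • cosBond M x y) - (J : ℂ) • sinBond M x y -
          ((J * (b x - b y) : ℝ) : ℂ) • (siteCos M x - siteCos M y) +
          ((J * (b x - b y) ^ 2 / 2 : ℝ) : ℂ) • (1 : Op (TorusSite d L) (2 * M + 1)), fun x y => by
            simp only [cosBond_comm M x y, sinBond_comm M x y]
            congr 2
            · rw [← neg_sub (b y) (b x), mul_neg, Complex.ofReal_neg, neg_smul, ← smul_neg, neg_sub]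
            · rw [← neg_sub (b y) (b x), neg_sq]⟩ e := by
  rw [sum_edgeFinset_torusGraph hL, rotorFieldHamiltonian, truncHamiltonian_torus_eq L M hL,
    rotorGradField, xyFieldEnergy]
  simp only [Sym2.lift_mk, smul_sum, sum_div, Complex.ofReal_sum, sum_smul, mul_sum]
  rw [sub_sub, sub_add, ← sum_add_distrib, ← sum_sub_distrib, sub_eq_add_neg, ← sum_neg_distrib]
  congr 1
  refine sum_congr rfl fun x _ => ?_
  rw [← sum_add_distrib, ← sum_sub_distrib, ← sum_neg_distrib]
  refine sum_congr rfl fun i _ => ?_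
  rw [← cosBond_add_sinBond]
  push_cast
  module

/-- **The momentum flip on the odd sublattice** ([KLS1988JSP] eqs. (15)–(16), rotator version):
on the even torus (`L ≥ 4`), conjugation by `⨂_{x odd} F_x` maps `H_M(b)` to `H♭(b)`; in
particular they have the same ground-state energy. [cite: KLS1988JSP, eqs. (15)–(17)] -/
theorem groundEnergy_rotorFieldHamiltonian_eq (hL : Even L) (hL3 : 3 ≤ L) (h J : ℝ)
    (b : TorusSite d L → ℝ) :
    (rotorFieldHamiltonian L M h J b).groundEnergy =
      (rotorRealFieldHamiltonian L M h J b).groundEnergy := by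
  obtain ⟨k, rfl⟩ : ∃ k, L = 2 * k := ⟨L / 2, by obtain ⟨k, hk⟩ := hL; omega⟩
  set E := (torusGraph d (2 * k)).edgeFinset with hE
  set F := truncFlip M with hF
  have hFF : F * Fᴴ = 1 := by rw [hF, truncFlip_conjTranspose, truncFlip_mul_self]
  have hFF' : Fᴴ * F = 1 := by rw [hF, truncFlip_conjTranspose, truncFlip_mul_self]
  -- the product unitary on the odd sublattice
  set ε : TorusSite d (2 * k) → ZMod 2 := fun x =>
    ∑ j, ZMod.castHom (dvd_mul_right 2 k) (ZMod 2) (x j) with hε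
  set u : TorusSite d (2 * k) → Matrix (Fin (2 * M + 1)) (Fin (2 * M + 1)) ℂ :=
    fun z => if ε z = 0 then 1 else F with hu
  have hua : ∀ z, u z * (u z)ᴴ = 1 := by
    intro z; simp only [hu]; split_ifs
    · rw [conjTranspose_one, Matrix.mul_one]
    · exact hFF
  have hua' : ∀ z, (u z)ᴴ * u z = 1 := by
    intro z; simp only [hu]; split_ifs
    · rw [conjTranspose_one, Matrix.mul_one]
    · exact hFF'
  set sgn : TorusSite d (2 * k) → ℂ := fun z => if ε z = 0 then 1 else -1 with hsgn
  have huc : ∀ z, u z * truncCos M * (u z)ᴴ = truncCos M := by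
    intro z; simp only [hu]; split_ifs
    · rw [conjTranspose_one, Matrix.mul_one, Matrix.one_mul]
    · rw [hF, truncFlip_conjTranspose, truncFlip_mul_truncCos_mul_truncFlip]
  have hus : ∀ z, u z * truncSin M * (u z)ᴴ = sgn z • truncSin M := by
    intro z; simp only [hu, hsgn]; split_ifs
    · rw [conjTranspose_one, Matrix.mul_one, Matrix.one_mul, one_smul]
    · rw [hF, truncFlip_conjTranspose, truncFlip_mul_truncSin_mul_truncFlip, neg_one_smul]
  have hun : ∀ z, u z * (truncMomentum M * truncMomentum M) * (u z)ᴴ =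
      truncMomentum M * truncMomentum M := by
    intro z; simp only [hu]; split_ifs
    · rw [conjTranspose_one, Matrix.mul_one, Matrix.one_mul]
    · rw [hF, truncFlip_conjTranspose, truncFlip_mul_truncMomentum_sq_mul_truncFlip]
  have hedge : ∀ e ∈ E, ∀ x y, e = s(x, y) → sgn x * sgn y = -1 := by
    intro e he x y hexy
    subst hexy
    rw [hE, SimpleGraph.mem_edgeFinset, SimpleGraph.mem_edgeSet, torusGraph_adj_iff] at he
    have h01 : ∀ t : ZMod 2, t = 0 ∨ t = 1 := by decide
    have key : ∀ x' : TorusSite d (2 * k), ∀ i, sgn x' * sgn (x' + Pi.single i 1) = -1 := by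
      intro x' i
      have hpar : ε (x' + Pi.single i 1) = ε x' + 1 := torusParity_add_single k x' i
      simp only [hsgn, hpar]
      rcases h01 (ε x') with h0 | h1
      · rw [if_pos h0, if_neg (by rw [h0]; decide), one_mul]
      · rw [if_neg (by rw [h1]; decide), if_pos (by rw [h1]; decide), mul_one]
    obtain ⟨-, ⟨i, rfl⟩ | ⟨i, rfl⟩⟩ := he
    · exact key x i
    · rw [mul_comm]; exact key y i
  set W := productOp u with hW
  have hWc : ∀ x : TorusSite d (2 * k), W * siteCos M x * Wᴴ = siteCos M x := by
    intro x
    rw [hW, siteCos, productOp_conj_onSite hua, huc]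
  have hWs : ∀ x : TorusSite d (2 * k), W * siteSin M x * Wᴴ = sgn x • siteSin M x := by
    intro x
    rw [hW, siteSin, productOp_conj_onSite hua, hus, onSite_smul']
  have hWn : ∀ x : TorusSite d (2 * k), W * siteMomentumSq M x * Wᴴ = siteMomentumSq M x := by
    intro x
    rw [hW, siteMomentumSq, productOp_conj_onSite hua, hun]
  have hWmul : ∀ A B : Op (TorusSite d (2 * k)) (2 * M + 1),
      W * (A * B) * Wᴴ = (W * A * Wᴴ) * (W * B * Wᴴ) := by
    intro A B
    have h1 : Wᴴ * W = 1 := by rw [hW]; exact productOp_conjTranspose_mul hua'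
    simp only [Matrix.mul_assoc]
    rw [← Matrix.mul_assoc Wᴴ W, h1, Matrix.one_mul]
  have hbc : ∀ x y : TorusSite d (2 * k), W * cosBond M x y * Wᴴ = cosBond M x y := by
    intro x y
    simp only [cosBond, Matrix.mul_smul, Matrix.smul_mul, Matrix.mul_add, Matrix.add_mul, hWmul,
      hWc]
  have hbs : ∀ x y : TorusSite d (2 * k), sgn x * sgn y = -1 →
      W * sinBond M x y * Wᴴ = -sinBond M x y := by
    intro x y hxy
    simp only [sinBond, Matrix.mul_smul, Matrix.smul_mul, Matrix.mul_add, Matrix.add_mul, hWmul,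
      hWs, smul_mul_smul_comm, mul_comm (sgn y) (sgn x), hxy]
    module
  have hW1 : W * (1 : Op (TorusSite d (2 * k)) (2 * M + 1)) * Wᴴ = 1 := by
    rw [Matrix.mul_one, hW, productOp_mul_conjTranspose hua]
  -- conjugate the edge sum
  have hHW : W * rotorFieldHamiltonian (2 * k) M h J b * Wᴴ =
      rotorRealFieldHamiltonian (2 * k) M h J b := by
    rw [rotorFieldHamiltonian_eq_edgeSum (2 * k) M hL3, rotorRealFieldHamiltonian, ← hE,
      Matrix.mul_add, Matrix.add_mul, Finset.mul_sum, Finset.sum_mul, Finset.mul_sum,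
      Finset.sum_mul]
    congr 1
    · refine sum_congr rfl fun x _ => ?_
      rw [Matrix.mul_smul, Matrix.smul_mul, hWn]
    · refine sum_congr rfl fun e he => ?_
      induction e using Sym2.ind with
      | h x y =>
        have hs := hedge _ he x y rfl
        simp only [Sym2.lift_mk, rotorRealBond, Matrix.mul_add, Matrix.add_mul, Matrix.mul_sub,
          Matrix.sub_mul, Matrix.mul_neg, Matrix.neg_mul, Matrix.mul_smul, Matrix.smul_mul, hbc,
          hbs x y hs, hW1, hWc, smul_neg, sub_neg_eq_add]
  have hU : W ∈ Matrix.unitaryGroup (TensorIndex (TorusSite d (2 * k)) (2 * M + 1)) ℂ :=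
    Matrix.mem_unitaryGroup_iff.2 (by rw [hW]; exact productOp_mul_conjTranspose hua)
  rw [← hHW, Matrix.groundEnergy_unitary_conj hU]

end Rotation

/-! ### Hermiticity and reality of the half-space operators; the reflection inequality -/

section HalfSpace

variable (L : ℕ) [NeZero L] (M : ℕ) (j : Fin d) (a : ZMod L)

/-- `H♭(b)` is Hermitian. [folklore] -/
theorem rotorRealFieldHamiltonian_isHermitian (h J : ℝ) (b : TorusSite d L → ℝ) :
    (rotorRealFieldHamiltonian L M h J b).IsHermitian := by
  unfold rotorRealFieldHamiltonian
  refine Matrix.IsHermitian.add ?_ (isHermitian_sum_lift _ _ fun x y => rotorRealBond_isHermitian M J b x y)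
  rw [IsHermitian, conjTranspose_sum]
  exact sum_congr rfl fun x _ => ((siteMomentumSq_isHermitian M x).smul (isSelfAdjoint_ofReal _)).eq

/-- `H^L(b)` is Hermitian. [folklore] -/
theorem rotorLeftHamiltonian_isHermitian (hL : Even L) (h J : ℝ) (b : TorusSite d L → ℝ) :
    (rotorLeftHamiltonian L M j a hL h J b).IsHermitian := by
  unfold rotorLeftHamiltonian
  refine (Matrix.IsHermitian.add ?_ ?_).add ?_
  · rw [IsHermitian, conjTranspose_sum]
    exact sum_congr rfl fun s _ => ((siteMomentumSq_isHermitian M _).smul (isSelfAdjoint_ofReal _)).eq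
  · rw [IsHermitian, conjTranspose_sum]
    refine sum_congr rfl fun e _ => ?_
    induction e using Sym2.ind with
    | h x y =>
      simp only [Sym2.lift_mk]
      exact (rotorRealBond_isHermitian M J _ _ _).eq
  · rw [IsHermitian, conjTranspose_sum]
    refine sum_congr rfl fun x _ => ?_
    exact ((isHermitian_one.smul (isSelfAdjoint_ofReal _)).sub
      ((siteCos_isHermitian M _).smul (isSelfAdjoint_ofReal _))).eq

/-- `H^L(b)` is a real matrix. [cite: KLS1988JSP, p. 1028] -/
theorem rotorLeftHamiltonian_transpose_eq (hL : Even L) (h J : ℝ) (b : TorusSite d L → ℝ) :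
    (rotorLeftHamiltonian L M j a hL h J b)ᵀ = (rotorLeftHamiltonian L M j a hL h J b)ᴴ := by
  unfold rotorLeftHamiltonian
  rw [transpose_add, conjTranspose_add, transpose_add, conjTranspose_add, transpose_sum,
    conjTranspose_sum, transpose_sum, conjTranspose_sum, transpose_sum, conjTranspose_sum]
  congr 1
  · congr 1
    · refine sum_congr rfl fun s _ => ?_
      exact transpose_eq_conjTranspose_ofReal_smul (siteMomentumSq_transpose_eq M _) _
    · refine sum_congr rfl fun e _ => ?_
      induction e using Sym2.ind with
      | h x y =>
        simp only [Sym2.lift_mk]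
        exact rotorRealBond_transpose_eq M J _ _ _
  · refine sum_congr rfl fun x _ => ?_
    exact transpose_eq_conjTranspose_sub
      (transpose_eq_conjTranspose_ofReal_smul transpose_eq_conjTranspose_one _)
      (transpose_eq_conjTranspose_ofReal_smul (siteCos_transpose_eq M _) _)

/-- `H^L(b)` is (complex-)symmetric: `(H^L)ᵀ = H^L`. [folklore] -/
theorem rotorLeftHamiltonian_transpose (hL : Even L) (h J : ℝ) (b : TorusSite d L → ℝ) :
    (rotorLeftHamiltonian L M j a hL h J b)ᵀ = rotorLeftHamiltonian L M j a hL h J b := by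
  rw [rotorLeftHamiltonian_transpose_eq, (rotorLeftHamiltonian_isHermitian L M j a hL h J b).eq]

/-- The crossing operators are real matrices. [cite: KLS1988JSP, p. 1028] -/
theorem rotorCrossOp_transpose_eq (hL : Even L) (J : ℝ) (b : TorusSite d L → ℝ)
    (i : torusCrossSites L j a × Bool) :
    (rotorCrossOp L M j a hL J b i)ᵀ = (rotorCrossOp L M j a hL J b i)ᴴ := by
  rcases i with ⟨x, _ | _⟩
  · exact transpose_eq_conjTranspose_ofReal_smul (transpose_eq_conjTranspose_sub
      (siteCos_transpose_eq M _)
      (transpose_eq_conjTranspose_ofReal_smul transpose_eq_conjTranspose_one _)) _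
  · exact transpose_eq_conjTranspose_ofReal_smul (I_smul_siteSin_transpose_eq M _) _

/-- `H^L(b)` depends on `b` only through `b` on the left half. [folklore] -/
theorem rotorLeftHamiltonian_congr (hL : Even L) (h J : ℝ) {b₁ b₂ : TorusSite d L → ℝ}
    (hb : ∀ x ∈ torusLeftHalf L j a, b₁ x = b₂ x) :
    rotorLeftHamiltonian L M j a hL h J b₁ = rotorLeftHamiltonian L M j a hL h J b₂ := by
  unfold rotorLeftHamiltonian
  congr 1
  · congr 1
    refine sum_congr rfl fun e _ => ?_
    induction e using Sym2.ind with
    | h x y =>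
      simp only [Sym2.lift_mk]
      exact rotorRealBond_congr M J (hb _ (torusToLeft L j a hL x).2) (hb _ (torusToLeft L j a hL y).2)
  · refine sum_congr rfl fun x hx => ?_
    rw [hb x (mem_filter.1 hx).1]

/-- The crossing operators depend on `b` only through `b` on the left half. [folklore] -/
theorem rotorCrossOp_congr (hL : Even L) (J : ℝ) {b₁ b₂ : TorusSite d L → ℝ}
    (hb : ∀ x ∈ torusLeftHalf L j a, b₁ x = b₂ x) :
    rotorCrossOp L M j a hL J b₁ = rotorCrossOp L M j a hL J b₂ := by
  funext i
  rcases i with ⟨x, _ | _⟩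
  · show _ • (siteCos M _ - _) = _ • (siteCos M _ - _)
    rw [hb x (mem_filter.1 x.2).1]
  · rfl

/-- **The reflection inequality for the ground-state energy** ([KLS1988JSP], the display after
eq. (25); [WojtkiewiczPuszStachura2016] Lemma 3.6): for the field Hamiltonian of the truncated
rotators on the even torus of side `L ≥ 4`, `J ≥ 0`, and every pair of planes,
`½E(b^L) + ½E(b^R) ≤ E(b)`. [cite: KLS1988JSP, eqs. (20)–(25)]
[cite: WojtkiewiczPuszStachura2016, Lemma 3.6] -/
theorem groundEnergy_reflect_le_rotor (hL : Even L) (hL3 : 3 ≤ L) (h : ℝ) {J : ℝ} (hJ : 0 ≤ J)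
    (b : TorusSite d L → ℝ) :
    ((rotorFieldHamiltonian L M h J (reflectFieldLeft L j a b)).groundEnergy +
        (rotorFieldHamiltonian L M h J (reflectFieldRight L j a b)).groundEnergy) / 2 ≤
      (rotorFieldHamiltonian L M h J b).groundEnergy := by
  rw [groundEnergy_rotorFieldHamiltonian_eq L M hL hL3, groundEnergy_rotorFieldHamiltonian_eq L M hL hL3,
    groundEnergy_rotorFieldHamiltonian_eq L M hL hL3]
  -- abbreviations
  set A := rotorLeftHamiltonian L M j a hL h J b with hA
  set B := rotorLeftHamiltonian L M j a hL h J (fun y => b (Torus.reflectBetweenSites j a y)) with hB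
  set P := rotorCrossOp L M j a hL J b with hP
  set Q := rotorCrossOp L M j a hL J (fun y => b (Torus.reflectBetweenSites j a y)) with hQ
  set e := torusSplit (q := 2 * M + 1) L j a hL with he
  -- the three Kronecker forms
  have hK : rotorRealFieldHamiltonian L M h J b =
      (A ⊗ₖ 1 + 1 ⊗ₖ B - ∑ i, P i ⊗ₖ Q i).submatrix e e :=
    rotorRealFieldHamiltonian_eq_submatrix L M j a hL h hJ b
  have hKL : rotorRealFieldHamiltonian L M h J (reflectFieldLeft L j a b) =
      (A ⊗ₖ 1 + 1 ⊗ₖ A - ∑ i, P i ⊗ₖ P i).submatrix e e := by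
    rw [rotorRealFieldHamiltonian_eq_submatrix L M j a hL h hJ,
      rotorLeftHamiltonian_congr L M j a hL h J (fun x hx => reflectFieldLeft_of_mem L j a b hx),
      rotorLeftHamiltonian_congr L M j a hL h J
        (fun x hx => reflectFieldLeft_reflectBetweenSites_of_mem L j a hL b hx),
      rotorCrossOp_congr L M j a hL J (fun x hx => reflectFieldLeft_of_mem L j a b hx),
      rotorCrossOp_congr L M j a hL J
        (fun x hx => reflectFieldLeft_reflectBetweenSites_of_mem L j a hL b hx)]
  have hKR : rotorRealFieldHamiltonian L M h J (reflectFieldRight L j a b) =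
      (B ⊗ₖ 1 + 1 ⊗ₖ B - ∑ i, Q i ⊗ₖ Q i).submatrix e e := by
    rw [rotorRealFieldHamiltonian_eq_submatrix L M j a hL h hJ,
      rotorLeftHamiltonian_congr L M j a hL h J (fun x hx => reflectFieldRight_of_mem L j a b hx),
      rotorLeftHamiltonian_congr L M j a hL h J
        (b₁ := fun y => reflectFieldRight L j a b (Torus.reflectBetweenSites j a y))
        (fun x hx => reflectFieldRight_reflectBetweenSites_of_mem L j a hL b hx),
      rotorCrossOp_congr L M j a hL J (fun x hx => reflectFieldRight_of_mem L j a b hx),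
      rotorCrossOp_congr L M j a hL J
        (b₁ := fun y => reflectFieldRight L j a b (Torus.reflectBetweenSites j a y))
        (fun x hx => reflectFieldRight_reflectBetweenSites_of_mem L j a hL b hx)]
  -- Hermiticity of the three forms
  have herm : ∀ (f : TorusSite d L → ℝ) (K : Matrix _ _ ℂ),
      rotorRealFieldHamiltonian L M h J f = K.submatrix e e → K.IsHermitian := by
    intro f K hf
    have : K = (rotorRealFieldHamiltonian L M h J f).submatrix e.symm e.symm := by
      rw [hf, submatrix_submatrix, Equiv.self_comp_symm, submatrix_id_id]
    rw [this]
    exact (rotorRealFieldHamiltonian_isHermitian L M h J f).submatrix _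
  haveI : Nonempty ((torusLeftHalf L j a → Fin (2 * M + 1)) × (torusLeftHalf L j a → Fin (2 * M + 1))) :=
    ⟨(fun _ => 0, fun _ => 0)⟩
  have hRP := Matrix.kls_groundEnergy_reflection A B P Q
    (rotorLeftHamiltonian_transpose L M j a hL h J b) (rotorLeftHamiltonian_transpose L M j a hL h J _)
    (fun i => rotorCrossOp_transpose_eq L M j a hL J b i)
    (fun i => rotorCrossOp_transpose_eq L M j a hL J _ i) (herm _ _ hK) (herm _ _ hKL) (herm _ _ hKR)
  rw [hK, hKL, hKR, Matrix.groundEnergy_submatrix_equiv (herm _ _ hK),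
    Matrix.groundEnergy_submatrix_equiv (herm _ _ hKL),
    Matrix.groundEnergy_submatrix_equiv (herm _ _ hKR)]
  exact hRP

end HalfSpace

/-! ### The descent on the number of bad bonds; Gaussian domination -/

section Descent

variable (L : ℕ) [NeZero L] (M : ℕ)

/-- **No bad bonds ⇒ `H_M(b) = H_M`**: if `b_x = b_y` on every bond then the field terms vanish.
[cite: KLS1988JSP, p. 1027] -/
theorem rotorFieldHamiltonian_eq_of_badBondCount_eq_zero (hL2 : 2 ≤ L) (h J : ℝ)
    {b : TorusSite d L → ℝ} (h0 : badBondCount L b = 0) :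
    rotorFieldHamiltonian L M h J b = truncHamiltonian M (torusGraph d L).Adj h J := by
  classical
  have hgood : ∀ (x : TorusSite d L) (i : Fin d), b x - b (x + Pi.single i 1) = 0 := by
    intro x i
    rw [badBondCount, Finset.card_eq_zero, Finset.filter_eq_empty_iff] at h0
    have he : s(x, x + Pi.single i 1) ∈ (torusGraph d L).edgeFinset := by
      rw [SimpleGraph.mem_edgeFinset, SimpleGraph.mem_edgeSet]
      exact Literature.Probability.LatticeModels.torusGraph_adj_add_single hL2 x i
    have h1 := h0 he
    rw [not_not, Sym2.map_mk, Sym2.mk_isDiag_iff] at h1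
    rw [h1, sub_self]
  have hV : rotorGradField L M b = 0 := by
    unfold rotorGradField
    exact sum_eq_zero fun x _ => sum_eq_zero fun i _ => by
      rw [hgood x i, Complex.ofReal_zero, zero_smul]
  have hQ : xyFieldEnergy L b = 0 := by
    unfold xyFieldEnergy
    exact sum_eq_zero fun x _ => sum_eq_zero fun i _ => by rw [hgood x i]; ring
  rw [rotorFieldHamiltonian, hV, hQ, smul_zero, sub_zero, mul_zero, zero_div, Complex.ofReal_zero,
    zero_smul, add_zero]

/-- **Gaussian domination for the ground-state energy of the truncated rotators**
([WojtkiewiczPuszStachura2016] Thm. 3.5, `E₀(b) ≥ E₀(0)`, here for the Galerkin matrices; the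
rotator analogue of the tree's `kls_xy_gaussianDomination_ground_holds`): on the even torus of
side `L ≥ 4`, for every `M`, `h`, `J ≥ 0` and every real field `b`, `E₀(H_M) ≤ E₀(H_M(b))`.
Proof ([KLS1988JSP] pp. 1027–1029): minimise `E(f) = E₀(H_M(f))` over the finitely many fields
`f` with values in the range of `b`, then the number of bonds with `f_x ≠ f_y`; if there were such
a bond, the planes through it give `½E(f^L) + ½E(f^R) ≤ E(f)` (`groundEnergy_reflect_le_rotor`),
so `f^L`, `f^R` are minimisers and one of them has fewer bad bonds (`badBondCount_reflect`) —
contradiction; hence `H_M(f) = H_M` and `E₀(H_M) ≤ E₀(H_M(b))`.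
[cite: WojtkiewiczPuszStachura2016, Thm. 3.5] [cite: KLS1988JSP, eq. (18), pp. 1027–1029] -/
theorem truncHamiltonian_groundEnergy_le_field (hL : Even L) (h4 : 4 ≤ L) (h : ℝ) {J : ℝ}
    (hJ : 0 ≤ J) (g : TorusSite d L → ℝ) :
    (truncHamiltonian M (torusGraph d L).Adj h J).groundEnergy ≤
      (rotorFieldHamiltonian L M h J g).groundEnergy := by
  classical
  have hL3 : 3 ≤ L := by omega
  have hL2 : 2 ≤ L := by omega
  -- the finite search space
  set V : Finset ℝ := (univ : Finset (TorusSite d L)).image g with hV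
  set Ef : (TorusSite d L → V) → ℝ := fun f =>
    (rotorFieldHamiltonian L M h J (fun x => (f x : ℝ))).groundEnergy with hEf
  set Nf : (TorusSite d L → V) → ℕ := fun f => badBondCount L (fun x => (f x : ℝ)) with hNf
  set g' : TorusSite d L → V := fun x => ⟨g x, mem_image_of_mem g (mem_univ x)⟩ with hg'
  haveI : Nonempty (TorusSite d L → V) := ⟨g'⟩
  obtain ⟨f₀, hf₀⟩ := Finite.exists_min Ef
  set S : Finset (TorusSite d L → V) := univ.filter fun f => Ef f = Ef f₀ with hS
  obtain ⟨f₁, hf₁S, hf₁min⟩ := S.exists_min_image Nf ⟨f₀, by simp [hS]⟩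
  have hEf₁ : Ef f₁ = Ef f₀ := (mem_filter.1 hf₁S).2
  -- the minimiser has no bad bonds
  have hN0 : Nf f₁ = 0 := by
    by_contra hN
    -- a bad pair `(x₀, i)`
    obtain ⟨x₀, i, hbad⟩ : ∃ (x₀ : TorusSite d L) (i : Fin d),
        (f₁ x₀ : ℝ) ≠ f₁ (x₀ + Pi.single i 1) := by
      obtain ⟨e, he⟩ := Finset.card_ne_zero.1 hN
      obtain ⟨heE, hbe⟩ := mem_filter.1 he
      revert heE hbe
      refine Sym2.ind (fun u v => ?_) e
      intro heE hbe
      rw [SimpleGraph.mem_edgeFinset, SimpleGraph.mem_edgeSet, torusGraph_adj_iff] at heE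
      rw [Sym2.map_mk, Sym2.mk_isDiag_iff] at hbe
      obtain ⟨-, ⟨i, rfl⟩ | ⟨i, rfl⟩⟩ := heE
      · exact ⟨u, i, hbe⟩
      · exact ⟨v, i, fun h' => hbe h'.symm⟩
    -- the planes through it
    set j := i
    obtain ⟨hxCS, hθx⟩ := add_single_mem_torusCrossSites L hL2 j x₀
    set a : ZMod L := x₀ j with ha
    -- the reflected fields, inside the search space
    set φ : TorusSite d L → ℝ := fun x => (f₁ x : ℝ) with hφ
    set fL : TorusSite d L → V := fun y =>
      if y ∈ torusLeftHalf L j a then f₁ y else f₁ (Torus.reflectBetweenSites j a y) with hfL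
    set fR : TorusSite d L → V := fun y =>
      if y ∈ torusLeftHalf L j a then f₁ (Torus.reflectBetweenSites j a y) else f₁ y with hfR
    have hfLφ : (fun x => (fL x : ℝ)) = reflectFieldLeft L j a φ := by
      funext y
      simp only [hfL, reflectFieldLeft, hφ]
      split_ifs <;> rfl
    have hfRφ : (fun x => (fR x : ℝ)) = reflectFieldRight L j a φ := by
      funext y
      simp only [hfR, reflectFieldRight, hφ]
      split_ifs <;> rfl
    -- energies: both reflected fields are minimisers
    have hRP := groundEnergy_reflect_le_rotor L M j a hL hL3 h hJ φ
    have hEL : Ef fL = (rotorFieldHamiltonian L M h J (reflectFieldLeft L j a φ)).groundEnergy := by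
      simp only [hEf, hfLφ]
    have hER : Ef fR = (rotorFieldHamiltonian L M h J (reflectFieldRight L j a φ)).groundEnergy := by
      simp only [hEf, hfRφ]
    have hE1 : Ef f₁ = (rotorFieldHamiltonian L M h J φ).groundEnergy := by simp only [hEf, hφ]
    have h1 := hf₀ fL
    have h2 := hf₀ fR
    rw [← hEL, ← hER, ← hE1, hEf₁] at hRP
    have hELm : Ef fL = Ef f₀ := by linarith
    have hERm : Ef fR = Ef f₀ := by linarith
    have hNL : Nf f₁ ≤ Nf fL := hf₁min fL (by simp [hS, hELm])
    have hNR : Nf f₁ ≤ Nf fR := hf₁min fR (by simp [hS, hERm])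
    -- counting: `N(f^L) + N(f^R) + 2N_C = 2N(f)` with `N_C ≥ 1`
    have hcount := badBondCount_reflect L j a hL φ
    have hNLφ : Nf fL = badBondCount L (reflectFieldLeft L j a φ) := by simp only [hNf, hfLφ]
    have hNRφ : Nf fR = badBondCount L (reflectFieldRight L j a φ) := by simp only [hNf, hfRφ]
    have hN1φ : Nf f₁ = badBondCount L φ := by simp only [hNf, hφ]
    have hC : 1 ≤ ∑ x ∈ torusCrossSites L j a,
        (if (Sym2.map φ s(x, Torus.reflectBetweenSites j a x)).IsDiag then 0 else 1) := by
      have hone : (if (Sym2.map φ s(x₀ + Pi.single j 1,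
          Torus.reflectBetweenSites j a (x₀ + Pi.single j 1))).IsDiag then 0 else 1) = 1 := by
        simp only [hθx, Sym2.map_mk, Sym2.mk_isDiag_iff]
        rw [if_neg]
        exact fun h' => hbad h'.symm
      calc 1 = (if (Sym2.map φ s(x₀ + Pi.single j 1,
          Torus.reflectBetweenSites j a (x₀ + Pi.single j 1))).IsDiag then 0 else 1) := hone.symm
        _ ≤ _ := Finset.single_le_sum (f := fun x =>
          if (Sym2.map φ s(x, Torus.reflectBetweenSites j a x)).IsDiag then 0 else 1)
          (fun _ _ => Nat.zero_le _) hxCS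
    rw [← hNLφ, ← hNRφ, ← hN1φ] at hcount
    omega
  -- hence `H(f₁) = H` and `E₀(H) = E(f₁) ≤ E(g)`
  have hH : rotorFieldHamiltonian L M h J (fun x => (f₁ x : ℝ)) = truncHamiltonian M (torusGraph d L).Adj h J :=
    rotorFieldHamiltonian_eq_of_badBondCount_eq_zero L M hL2 h J hN0
  have hEg : Ef g' = (rotorFieldHamiltonian L M h J g).groundEnergy := by simp only [hEf, hg']
  have h1 : Ef f₁ = (truncHamiltonian M (torusGraph d L).Adj h J).groundEnergy := by
    simp only [hEf, hH]
  rw [← hEg, ← h1, hEf₁]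
  exact hf₀ g'

end Descent

end QuantumRotor

end Literature.MathematicalPhysics.QuantumLattice
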